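import Literature.Topology.FourManifolds.SurfaceGroupRelatorCircuit
import Literature.Topology.FourManifolds.SurfaceGroupCayleyFaces
import Literature.GroupTheory.CombinatorialGroupTheory.QuadraticWordsReduction
import Literature.GroupTheory.CombinatorialGroupTheory.QuadraticWordsSpikes
import Literature.GroupTheory.CombinatorialGroupTheory.BinaryProductTiling
import Literature.GroupTheory.CombinatorialGroupTheory.FreeGroupCyclicConjugates
import HarnessLib

/-!
# Zieschang's theorem on binary products with the value of the surface relator, cyclic form

Topic `Literature/Topology/FourManifolds`.  The bridge between Zieschang's Nielsen reduction of a
binary product (`QuadraticWordsReduction.lean`, ZVC Thm. 5.2.6), the kernel tiling of a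
cyclically Nielsen-reduced cyclic product (`BinaryProductTiling.lean`) and the rigidity theorem
for spike configurations (`QuadraticWordsSpikes.lean`), giving the cyclic form of
Zieschang–Vogt–Coldewey, *Surfaces and Planar Discontinuous Groups*, LNM 835 (1980), Thm. 5.2.8
(orientable closed case):

* `SurfaceGroup.toWord_eq_singleton_of_cyclicallyReduced` — if an assignment `X` of the
  symbols of a quadratic word `w` with `4g` letters in the free group `F⟨a, b⟩` has value
  conjugate to `r_g = ∏ [aᵢ, bᵢ]` and the cyclic sequence of values of the letters of `w` is
  cyclically Nielsen reduced, then EVERY VALUE IS A SINGLE LETTER: the `k`-th value is the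
  letter `(k + t) mod 4g` of the relator word `a₀ b₀ a₀⁻¹ b₀⁻¹ a₁ ⋯`, for a fixed rotation `t`.

Proof.  The value words have the cyclic Nielsen property (`cycNielsen_map_toWord`), so the
product is conjugate to the closed path of the kernels, which is cyclically reduced and hence a
rotation of the relator word (rotation lemma); it has length `4g`, so each of the `4g` non-empty
kernels is a single letter.  The heads (spikes), the kernel letters, and the pairing of the
letters of `w` by partners form a `SpikeConfig` (the relator word is injective on a period, its
inverse letters sit at `blockStar`-related positions, and it contains every letter), whose spikes
are all empty by `SpikeConfig.A_eq_nil`.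

Also here: the relator word is cyclically reduced (`isCyclicallyReduced_surfaceWordStd`) and its
inverse letters (`getElem_surfaceWordStd_blockStar`).

## References

* H. Zieschang, E. Vogt, H.-D. Coldewey, *Surfaces and Planar Discontinuous Groups*, LNM 835
  (1980), §5.2, Thm. 5.2.6, Thm. 5.2.8, Cor. 5.2.13. [ZieschangVogtColdewey1980]
* H. Zieschang, *Alternierende Produkte in freien Gruppen*, Abh. Math. Sem. Univ. Hamburg 27
  (1964) 13–31. [Zieschang1964]
-/

noncomputable section

namespace Literature.Topology.FourManifolds

open Literature.GroupTheory.CombinatorialGroupTheory List CycFactors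

namespace SurfaceGroup

variable {g : ℕ}

/-! ## The relator word: letters, inverse letters, cyclic reducedness -/

/-- The letters of a block and their inverses: letter `(t + 2) mod 4` of a block is the inverse of
letter `t`. [folklore] -/
theorem getElem_handleBlock_add_two (i : Fin g) {t : ℕ} (ht : t < 4)
    {h1 : (t + 2) % 4 < (handleBlock i).length} {h2 : t < (handleBlock i).length} :
    (handleBlock i)[(t + 2) % 4] = (((handleBlock i)[t]).1, !((handleBlock i)[t]).2) := by
  have : t = 0 ∨ t = 1 ∨ t = 2 ∨ t = 3 := by omega
  rcases this with rfl | rfl | rfl | rfl <;> rfl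

/-- **The inverse letters of the relator word sit at `blockStar`-related positions**: letter
`blockStar m` of `a₀b₀a₀⁻¹b₀⁻¹a₁⋯` is the inverse of letter `m`. [folklore] -/
theorem getElem_surfaceWordStd_blockStar {m : ℕ} (hm : m < 4 * g)
    {h1 : blockStar m < (surfaceWordStd g).length} {h2 : m < (surfaceWordStd g).length} :
    (surfaceWordStd g)[blockStar m] = (((surfaceWordStd g)[m]).1, !((surfaceWordStd g)[m]).2) := by
  have hi : m / 4 < g := by omega
  rw [getElem_surfaceWordStd (k := m) ⟨m / 4, hi⟩ (t := m % 4) (Nat.mod_lt _ (by norm_num))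
      (show m = 4 * (m / 4) + m % 4 by omega),
    getElem_surfaceWordStd (k := blockStar m) ⟨m / 4, hi⟩ (t := (m % 4 + 2) % 4)
      (Nat.mod_lt _ (by norm_num)) (show blockStar m = 4 * (m / 4) + (m % 4 + 2) % 4 from rfl)]
  exact getElem_handleBlock_add_two _ (Nat.mod_lt _ (by norm_num))

/-- `blockStar` keeps positions below a multiple of four below it. [folklore] -/
theorem blockStar_lt {m n : ℕ} (hm : m < 4 * n) : blockStar m < 4 * n := by
  unfold blockStar; omega

/-- `blockStar` commutes with reduction modulo `4g`. [folklore] -/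
theorem blockStar_mod (m g : ℕ) (hg : 0 < g) : blockStar m % (4 * g) = blockStar (m % (4 * g)) := by
  have e : blockStar m = blockStar (m % (4 * g)) + 4 * (g * (m / (4 * g))) := by
    conv_lhs => rw [← Nat.mod_add_div m (4 * g), show 4 * g * (m / (4 * g)) = 4 * (g * (m / (4 * g))) by ring]
    exact blockStar_add_four_mul _ _
  rw [e, show 4 * (g * (m / (4 * g))) = (m / (4 * g)) * (4 * g) by ring, Nat.add_mul_mod_self_right,
    Nat.mod_eq_of_lt (blockStar_lt (Nat.mod_lt _ (by omega)))]

/-- **The relator word is cyclically reduced.** [folklore] -/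
theorem isCyclicallyReduced_surfaceWordStd (g : ℕ) : FreeGroup.IsCyclicallyReduced (surfaceWordStd g) := by
  refine ⟨isReduced_surfaceWordStd g, fun a ha b hb hab => ?_⟩
  rcases Nat.eq_zero_or_pos g with rfl | hg
  · simp [surfaceWordStd] at hb
  have hlen := length_surfaceWordStd g
  rw [getLast?_eq_getElem?, hlen, getElem?_eq_getElem (by rw [hlen]; omega), Option.mem_def,
    Option.some.injEq] at ha
  rw [head?_eq_getElem?, getElem?_eq_getElem (by rw [hlen]; omega), Option.mem_def,
    Option.some.injEq] at hb
  rw [getElem_surfaceWordStd ⟨g - 1, by omega⟩ (t := 3) (by norm_num) (by simp; omega)] at ha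
  rw [getElem_surfaceWordStd ⟨0, hg⟩ (t := 0) (by norm_num) (by simp)] at hb
  subst ha hb
  have := congrArg Prod.snd hab
  exact Bool.noConfusion this

/-! ## A counting lemma -/

/-- If `m` numbers `≥ 1` add up to `m`, each of them is `1`. [folklore] -/
theorem eq_one_of_sum_map_range_eq (f : ℕ → ℕ) :
    ∀ m, (∀ k, k < m → 1 ≤ f k) → ((List.range m).map f).sum = m → ∀ k, k < m → f k = 1 := by
  have hle : ∀ m, (∀ k, k < m → 1 ≤ f k) → m ≤ ((List.range m).map f).sum := by
    intro m hm
    induction m with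
    | zero => simp
    | succ m ih =>
      rw [List.range_succ, List.map_append, List.sum_append, List.map_singleton, List.sum_singleton]
      have := ih fun k hk => hm k (by omega)
      have := hm m (by omega)
      omega
  intro m hm hsum k hk
  induction m with
  | zero => omega
  | succ m ih =>
    rw [List.range_succ, List.map_append, List.sum_append, List.map_singleton, List.sum_singleton] at hsum
    have h1 := hle m fun j hj => hm j (by omega)
    have h2 := hm m (by omega)
    rcases Nat.lt_succ_iff_lt_or_eq.1 hk with hk | rfl
    · exact ih (fun j hj => hm j (by omega)) (by omega) hk
    · omega

/-- A concatenation of one-letter words is the list of the letters. [folklore] -/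
theorem flatMap_range_eq_map {β : Type*} (f : ℕ → List β) (c : ℕ → β) :
    ∀ m, (∀ k, k < m → f k = [c k]) → (List.range m).flatMap f = (List.range m).map c := by
  intro m hm
  induction m with
  | zero => simp
  | succ m ih =>
    rw [List.range_succ, List.flatMap_append, List.map_append, ih fun k hk => hm k (by omega),
      List.flatMap_singleton, hm m (by omega), List.map_singleton]

/-! ## Single-letter values -/

/-- **Zieschang's theorem on binary products with the value of the surface relator, cyclic form**
(ZVC Thm. 5.2.8, orientable closed case).  Let `w` be a quadratic word with `4g` letters
(`g ≥ 1`) and `X` an assignment of its symbols in the free group `F⟨a, b⟩` whose value `X̂(w)` is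
conjugate to `r_g`, such that the cyclic sequence of values of the letters of `w` is cyclically
Nielsen reduced.  Then, for a fixed rotation `t`, the value of the `k`-th letter of `w` is the
single letter `(k + t) mod 4g` of the relator word `a₀ b₀ a₀⁻¹ b₀⁻¹ a₁ ⋯`.
[cite: ZieschangVogtColdewey1980, Thm. 5.2.8] -/
theorem toWord_eq_singleton_of_cyclicallyReduced {ι : Type*} [DecidableEq ι] (hg : 1 ≤ g)
    (w : List (ι × Bool)) (hq : IsQuadratic w) (hlen : w.length = 4 * g)
    (X : ι → FreeGroup (surfaceGen g)) (d : FreeGroup (surfaceGen g))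
    (hval : FreeGroup.lift X (FreeGroup.mk w) = d * surfaceRelator g * d⁻¹)
    (hcr : CyclicallyReduced (w.map fun x => FreeGroup.lift X (sgen x.1 x.2))) :
    ∃ t, ∀ (k : ℕ) (hk : k < w.length),
      (FreeGroup.lift X (sgen (w[k]).1 (w[k]).2)).toWord =
        [(surfaceWordStd g)[(k + t) % (4 * g)]'(by
          rw [length_surfaceWordStd]; exact Nat.mod_lt _ (by omega))] := by
  -- the cyclic list of value words
  set vals : List (FreeGroup (surfaceGen g)) := w.map fun x => FreeGroup.lift X (sgen x.1 x.2) with hvals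
  set U : List (List (surfaceGen g × Bool)) := vals.map FreeGroup.toWord with hUdef
  set N := 4 * g with hN
  have hNpos : 0 < N := by omega
  have hlenv : vals.length = N := by rw [hvals, length_map, hlen]
  have hlenU : U.length = N := by rw [hUdef, length_map, hlenv]
  have hUne : U ≠ [] := by rw [Ne, ← length_eq_zero_iff, hlenU]; omega
  have hsw : (surfaceWordStd g).length = N := length_surfaceWordStd g
  -- the cyclic Nielsen property of the value words
  have hCN : CycNielsen U := cycNielsen_map_toWord (by rw [hlenv]; omega) hcr
  -- the factors
  have hfacU : ∀ (k : ℕ) (hk : k < N), fac U k =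
      (FreeGroup.lift X (sgen (w[k]'(by rw [hlen]; exact hk)).1 (w[k]'(by rw [hlen]; exact hk)).2)).toWord := by
    intro k hk
    rw [fac_eq_getElem U (by rw [hlenU]; exact hk)]
    simp [hUdef, hvals]
  -- the value is the product of the factors
  have hprod : (U.map FreeGroup.mk).prod = d * FreeGroup.mk (surfaceWordStd g) * d⁻¹ := by
    have e1 : U.map FreeGroup.mk = vals := by
      rw [hUdef, map_map]
      conv_rhs => rw [← map_id vals]
      exact map_congr_left fun x _ => FreeGroup.mk_toWord
    have e2 : vals = w.map (val X) := map_congr_left fun x _ => lift_sgen X x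
    rw [e1, e2, ← lift_mk_eq_prod_map_val, hval, mk_surfaceWordStd]
  -- the closed path is a rotation of the relator word
  have hconj : FreeGroup.mk (closedPath U) =
      ((FreeGroup.mk (CycFactors.head U 0))⁻¹ * d) * FreeGroup.mk (surfaceWordStd g) *
        ((FreeGroup.mk (CycFactors.head U 0))⁻¹ * d)⁻¹ := by
    have := prod_map_mk_eq_conj hCN
    rw [hprod] at this
    rw [mul_inv_rev, inv_inv]
    calc FreeGroup.mk (closedPath U)
        = (FreeGroup.mk (CycFactors.head U 0))⁻¹ *
            (FreeGroup.mk (CycFactors.head U 0) * FreeGroup.mk (closedPath U) *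
              (FreeGroup.mk (CycFactors.head U 0))⁻¹) * FreeGroup.mk (CycFactors.head U 0) := by group
      _ = _ := by rw [← this]; group
  obtain ⟨t, ht⟩ := exists_rotate_eq_of_isCyclicallyReduced_conj (isCyclicallyReduced_surfaceWordStd g)
    (isCyclicallyReduced_closedPath hCN hUne) _ hconj
  -- hence every kernel is a single letter
  have hklen : ∀ k, k < N → (fac U k).length - jc U (cpred U k) - jc U k = 1 := by
    have hsum := hCN.length_closedPath_eq
    rw [ht, length_rotate, hsw, hlenU] at hsum
    exact eq_one_of_sum_map_range_eq _ N (fun k _ => by have := hCN.jc_add_jc_lt hUne k; omega) hsum.symm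
  have hker1 : ∀ k, k < N → (kernel U k).length = 1 := fun k hk => by
    rw [length_kernel U k (hCN.jc_add_jc_le k)]; exact hklen k hk
  -- the kernel letters
  have hkerc : ∃ c : ℕ → surfaceGen g × Bool, ∀ k, k < N → kernel U k = [c k] := by
    have : ∀ k, ∃ ck : surfaceGen g × Bool, k < N → kernel U k = [ck] := by
      intro k
      by_cases hk : k < N
      · obtain ⟨ck, hck⟩ := length_eq_one_iff.1 (hker1 k hk)
        exact ⟨ck, fun _ => hck⟩
      · exact ⟨((⟨0, by omega⟩, false), false), fun h => absurd h hk⟩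
    choose c hc using this
    exact ⟨c, hc⟩
  obtain ⟨c, hc⟩ := hkerc
  have hcp : closedPath U = (List.range N).map c := by
    rw [closedPath, hlenU]; exact flatMap_range_eq_map _ c N hc
  have hceq : ∀ (k : ℕ) (hk : k < N), c k =
      (surfaceWordStd g)[(k + t) % N]'(by rw [hsw]; exact Nat.mod_lt _ hNpos) := by
    intro k hk
    have e : ((List.range N).map c)[k]'(by simpa using hk) = ((surfaceWordStd g).rotate t)[k]'(by
        rw [length_rotate, hsw]; exact hk) := by
      simp only [← hcp, ht]
    rw [getElem_map, getElem_range, getElem_rotate] at e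
    rw [e]
    simp only [hsw]
  -- the kernel of every factor, cyclically
  have hkerρ : ∀ k, kernel U k = [(surfaceWordStd g)[(k + t) % N]'(by rw [hsw]; exact Nat.mod_lt _ hNpos)] := by
    intro k
    have e1 : kernel U k = kernel U (k % N) := by
      conv_lhs => rw [← Nat.mod_add_div k N]
      generalize k / N = q
      induction q with
      | zero => simp
      | succ q ih => rw [Nat.mul_succ, ← add_assoc, ← hlenU, kernel_add_length, hlenU, ih]
    rw [e1, hc _ (Nat.mod_lt _ hNpos), hceq _ (Nat.mod_lt _ hNpos)]
    congr 2
    rw [Nat.mod_add_mod]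
  -- the decomposition of every factor: head ++ kernel letter ++ invRev (next head)
  have hdec : ∀ k, fac U k = CycFactors.head U k ++
      (surfaceWordStd g)[(k + t) % N]'(by rw [hsw]; exact Nat.mod_lt _ hNpos) ::
        FreeGroup.invRev (CycFactors.head U (k + 1)) := by
    intro k
    rw [← head_append_kernel_append_tail U k (hCN.jc_add_jc_le k), hkerρ, tail_eq_invRev_head_succ,
      append_assoc, singleton_append]
  -- the factor lengths
  have hfaclen : ∀ k, (fac U k).length = jc U (cpred U k) + 1 + jc U k := by
    intro k
    have := congrArg length (hdec k)
    rw [length_append, length_cons, FreeGroup.invRev_length, length_head, length_head,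
      jc_cpred_succ] at this
    omega
  -- the pairing by partner letters
  have hpart : ∀ (k : ℕ) (hk : k < N), ∃ j, j < N ∧ fac U j = FreeGroup.invRev (fac U k) := by
    intro k hk
    have hk' : k < w.length := by rw [hlen]; exact hk
    have hmem : ((w[k]).1, !(w[k]).2) ∈ w := hq.partner_mem (getElem_mem hk')
    obtain ⟨j, hj, hwj⟩ := getElem_of_mem hmem
    refine ⟨j, by rw [← hlen]; exact hj, ?_⟩
    rw [hfacU j (by rw [← hlen]; exact hj), hfacU k hk, ← FreeGroup.toWord_inv]
    simp only [hwj, sgen_not, map_inv]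
  choose! bar hbar using hpart
  -- the spike configuration, re-indexed so that the kernel of side `i` is letter `i` of `r`
  set sh := N - t % N with hsh
  have hsht : (t % N + sh) = N := by have := Nat.mod_lt t hNpos; omega
  have hρidx : ∀ i, i % N < (surfaceWordStd g).length := fun i => by rw [hsw]; exact Nat.mod_lt _ hNpos
  have hshN : (sh + t) % N = 0 := by
    rw [Nat.add_mod, Nat.mod_add_mod, show sh + t % N = N by omega, Nat.mod_self]
  have hidx : ∀ j, (j + sh + t) % N = j % N := fun j => by
    rw [add_assoc, Nat.add_mod, hshN, add_zero, Nat.mod_mod]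
  let C : SpikeConfig (surfaceGen g) :=
    { g := g
      ρ := fun i => (surfaceWordStd g)[i % N]'(hρidx i)
      A := fun i => CycFactors.head U (i + sh)
      s := fun i => bar ((i + sh) % N) + t % N
      g_pos := hg
      ρ_periodic := fun i => by simp [hN]
      ρ_inj := fun k l hkl => (nodup_surfaceWordStd g).getElem_inj_iff.1 hkl
      ρ_blockStar := fun k => by
        have e := getElem_surfaceWordStd_blockStar (g := g) (m := k % N) (Nat.mod_lt _ hNpos)
          (h1 := by rw [hsw]; exact blockStar_lt (Nat.mod_lt _ hNpos)) (h2 := hρidx k)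
        rw [← e]
        congr 1
        exact blockStar_mod k g hg
      A_periodic := fun i => by
        show CycFactors.head U (i + 4 * g + sh) = CycFactors.head U (i + sh)
        rw [show i + 4 * g + sh = (i + sh) + U.length by rw [hlenU]; omega, head_add_length]
      isReduced := fun i => by
        have e := hidx i
        have h := hCN.reduced _ (fac_mem U hUne (i + sh))
        rw [hdec (i + sh)] at h
        simp only [e, show i + sh + 1 = i + 1 + sh by ring] at h
        exact h
      pair := fun i => by
        have e := hidx
        have hfac : ∀ j, fac U (j + sh) = CycFactors.head U (j + sh) ++
            (surfaceWordStd g)[j % N]'(hρidx j) :: FreeGroup.invRev (CycFactors.head U (j + 1 + sh)) := by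
          intro j
          rw [hdec (j + sh)]
          simp only [e, show j + sh + 1 = j + 1 + sh by ring]
        obtain ⟨-, hb⟩ := hbar ((i + sh) % N) (Nat.mod_lt _ hNpos)
        show CycFactors.head U (bar ((i + sh) % N) + t % N + sh) ++
            (surfaceWordStd g)[(bar ((i + sh) % N) + t % N) % N]'(hρidx _) ::
              FreeGroup.invRev (CycFactors.head U (bar ((i + sh) % N) + t % N + 1 + sh)) =
          FreeGroup.invRev (CycFactors.head U (i + sh) ++ (surfaceWordStd g)[i % N]'(hρidx i) ::
            FreeGroup.invRev (CycFactors.head U (i + 1 + sh)))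
        rw [← hfac i, show bar ((i + sh) % N) + t % N + 1 + sh = (bar ((i + sh) % N) + t % N) + 1 + sh by ring,
          ← hfac (bar ((i + sh) % N) + t % N),
          show bar ((i + sh) % N) + t % N + sh = bar ((i + sh) % N) + U.length by rw [hlenU]; omega,
          fac_add_length, hb]
        conv_rhs => rw [← fac_mod, hlenU]
      length_le_succ := fun i => by
        rw [length_head, length_head, show i + 1 + sh = (i + sh) + 1 by ring, jc_cpred_succ]
        have h1 := (hCN.pair (cpred U (i + sh))).2
        rw [fac_cpred_succ, hfaclen] at h1
        omega
      length_succ_le := fun i => by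
        rw [length_head, length_head, show i + 1 + sh = (i + sh) + 1 by ring, jc_cpred_succ]
        have h1 := (hCN.pair (i + sh)).1
        rw [hfaclen] at h1
        omega }
  have hsurj : ∀ x, ∃ k, C.ρ k = x := by
    intro x
    obtain ⟨n, hn, hnx⟩ := getElem_of_mem (mem_surfaceWordStd x)
    refine ⟨n, ?_⟩
    show (surfaceWordStd g)[n % N]'_ = x
    simp only [Nat.mod_eq_of_lt (show n < N by rwa [hsw] at hn), hnx]
  have hA := C.A_eq_nil hsurj
  -- all heads are empty
  have hhead : ∀ k, CycFactors.head U k = [] := by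
    intro k
    have := hA (k + t % N)
    change CycFactors.head U (k + t % N + sh) = [] at this
    rwa [add_assoc, hsht, ← hlenU, head_add_length] at this
  refine ⟨t, fun k hk => ?_⟩
  have hk' : k < N := by rw [hlen] at hk; exact hk
  rw [← hfacU k hk', hdec k, hhead, hhead]
  rfl

end SurfaceGroup

end Literature.Topology.FourManifolds
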